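import Summits.AtomisticToContinuum.Crystallization.Theorems.ChartedZeroExcessLayeredLatticeLiouvilleZZZU

/-!
# ChartedZeroExcess · LayeredLatticeLiouville ZZZWA (lens-2 g89 NODE 89 part 2 «CoherentMoat», file 1 of 2: ZZZW-1 · ZZZW-2 · ZZZW-3) — the R-A-min re-typing of the W2 line after the
# finding «STACK-WINDOW» (critic row 1583): COHERENT moat tameness, the re-typed special-class leaf (SC♮) `CoherentZoneShadowCrystalP`, the re-typed
# targets [MCMCᶜ♮] `MildCoherentMoatClampedCoreP` / [MCMC♮] `MildCoherentMoatCorePG`, the doors W2c (`[MCMC♮](ϑc) ⟸ (SC♮) ∧ (X1ᴸ) ∧ (X2ᴸ) ∧ (RGᴸ) ∧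
# (UXᴸ)_fat ∧ (DWᴹ)`, PROVED), and the two upstream entry points of the ♮-column (the Ψ-serene key lemma and the sitewise exclusion under [MCMC♮], PROVED)

WHY (finding «STACK-WINDOW», lens-2 g89; RULED critic row 1583).  The special-class leaf (SC) `CoolZoneShadowCrystalP` of every W2 door asks, in clause (iii)
of `IsCoolShadowCrystal`, that EVERY radius-`Rs = 5` environment of EVERY site of the synthesised crystal `H₀` be `10⁻⁴`-shadowed in the chart crystal `H`,
while its hypotheses tie `S` to `H` only through PER-STAR tameness (`IsTameStar`: ONE rotation and ONE map into `H` per radius-`4` star, no coherence across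
stars).  A relaxed Barlow polytype `S = (+¹⁰ −¹⁰)^∞` against the admissible chart `H = (+²⁰ −²⁰)^∞` satisfies every hypothesis (each radius-`4` star sees at
most one fault) and violates the conclusion (a radius-`5` environment of `H₀ ⊇ S`'s zone stacking sees two faults `10` apart; no environment of `H` does):
(SC) is false at every operating point, and no kinematic proof of it can exist.  At ROUTE level the witness is excluded by what the leaf FORGOT: upstream,
the chart comes WITH ONE window registration `Ψ : S → H` and tilt–strain data `(Q, σ)` (`IsGlobalReg`, `IsTiltStrainData`, parts Q/TR), and
`isTameStar_of_tiltStrainData` (part UC) is exactly where the coherence is dropped (`(U, g) := (Q x, Ψ)` star by star).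

WHAT (R-A-min, critic row 1583 (C)).
* ZZZW-1 `IsCoherentTameOn ϑ S H K` — ONE map `Ψ` into `H` and a rotation field `Q` on `K` such that every `4`-bond at every site of `K`, rotated by `Q x`,
  matches its `Ψ`-image within `ϑ` (= `IsTiltStrainData` localised to `K` with `σ ≤ ϑ`); the one-line bridge `IsCoherentTameOn.isTameOn` to the per-star
  notion, monotonicity, the vacuity guard `K = ∅`, and the dictionary `isCoherentTameOn_of_tiltStrainData`.  The Ψ-observer notions of the ♮-column:
  `IsPsiCool` (the star of `y` is `ϑc`-matched BY `Ψ` ITSELF), `IsPsiFarWarm` (tame-balled and not Ψ-cool), `IsPsiAgitated` (a Ψ-far-warm site within `ra`);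
  the Chebyshev handle `lt_sigma_of_psiFarWarm` (a Ψ-far-warm window site has `σ > ϑc` for ANY tilt–strain data of `Ψ` — so the Ψ-far-warm count is paid by
  the same tame-ball cubic mass as part YE's `[FWSᵇ]`); the ♮ KEY LEMMA `isCoherentTameOn_moat_hotCluster_of_psiSerene` (the moat of the hot cluster of a
  Ψ-SERENE ISOLATED site is COHERENTLY `ϑc`-tame — part YFA's key lemma with the coherence kept).
* ZZZW-2 the re-typed leaf and targets: (SC♮) `CoherentZoneShadowCrystalP` = (SC) with the cool-moat hypothesis replaced by `IsCoherentTameOn ϑc`,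
  conclusion VERBATIM (`∃ L′ w′ U t, IsCoolShadowCrystal …` — so every landed consumer of the placed crystal, nodes 84–89, is untouched); [MCMCᶜ♮]
  `MildCoherentMoatClampedCoreP`, [MCMC♮] `MildCoherentMoatCorePG` likewise.  PROVED comparisons: (SC) ⇒ (SC♮), [MCMCᶜ] ⇒ [MCMCᶜ♮], [MCMC] ⇒ [MCMC♮]
  (the ♮-statements are WEAKER — they are what the line can honestly deliver), [MCMCᶜ♮](ρ) ⇒ [MCMC♮], [MCMC♮] antitone in the moat level.
* ZZZW-3 the ♮ sitewise exclusion `not_hot_psiSerene_isolated_mild_of_mildCoherentMoatCore`: under [MCMC♮] (`0 ≤ q`, `ra ≥ r + rsh + q`, `D ≥ 2r + rsh + q`,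
  `rp ≥ q + rm`) no site of a θ-good e⋆-GSC door set is HOT ∧ Ψ-SERENE ∧ ISOLATED ∧ MILD-BALLED — part YHA's exclusion with `¬ IsAgitated` replaced by
  `¬ IsPsiAgitated`; this is the theorem the re-typed counting column (YE-2♮: the functionals `cnt S H Ψ Q` of `CountSparseBPG` DO receive `Ψ`) will call.
* ZZZW-4 the doors (PROVED, every proof a re-threading of the landed chain ZZZR → ZZZS → ZZZT → ZZZU with (SC♮) at the one place where (SC) met the binders,
  `mildCoolMoatClampedCoreP_of_minInLabelTube`): `mildCoherentMoatClampedCoreP_of_minInLabelTube` ((SC♮) ∧ (GL₂) ∧ (XRᴸ) ∧ (OMᴸ) ⟹ [MCMCᶜ♮]),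
  `mildCoherentMoatCorePG_OM_record`, `mildCoherentMoatCorePG_W2c_record` (= W2‴-record♮: (SC♮) ∧ (X1ᴸ) ∧ (X2ᴸ) ∧ (RGᴸ)(cR) ∧ (TGᴸ)(m₀) ∧ (DWᴹ)(cE, σ₀)),
  `mildCoherentMoatCorePG_W2c_fat`, `mildCoherentMoatCorePG_W2c_fat_of_bondExit`, `mildCoherentMoatCorePG_W2c` (= W2⁗♮: `[MCMC♮](ϑc) ⟸ (SC♮) ∧ (X1ᴸ)(lam > 0) ∧
  (X2ᴸ) ∧ (RGᴸ)(cR) ∧ (UXᴸ)_fat ∧ (DWᴹ)(cE, σ₀)`, `σ₀ < cE·cR·10⁻⁴`).  With NODE 89 part 1 (tree ZZZV, `offTubeBulkExitP_fat`) the hypothesis `hUX` is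
  discharged by one application (door W2c⁺, to be filed over ZZZV once it is in the tree).

TAGS.  (SC♮) [KINEMATIC · ATTACKABLE · the intended proof takes `H₀ := H` (`L′ := L`, `w′ := w`): clause (iii) is then trivial at every radius
(`isCoolShadowCrystal_self`), the content is REG (iv)/(v) = ONE rigid motion `10⁻⁴`-close to `Ψ` on the zone `8 < dist(·,K) < 43/2`, by frame propagation
along bonded chains of the coherently tame moat (`Q x ≈ Q y` for bonded sites sharing non-collinear `4`-bonds) or by a discrete John/FJM estimate; dial
`ε ≈ 10–250·ϑc`; caveat «SEP-MARGIN»: clause (ii) asks `IsSep (17/20) H₀`, while a registered `H₀` inherits only the door set's certified hard core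
`27/32 = 0.84375` (`isSep_of_isDoorSetP`) — either the column certifies `≥ 17/20 + 2ε` on registered zones or the leaf's `σ` is re-dialled to
`σ′ ∈ (2·dB, 27/32 − 2ε]`, e.g. `421/500` at `dB = 21/50`]; [MCMC♮] / [MCMCᶜ♮] [targets of record of the W2 line after row 1583]; the upstream obligation (c1)
[BOOKKEEPING · the B-body `CountSparseBPG` quantifies `∀ Ψ, IsGlobalReg Cg η R S H Ψ → IsBondIso S Ψ → cnt S H Ψ (win R) ≤ …` — ONE `Ψ` IS in scope; the
serene/agitated column YE-2/YFA/YHA is re-typed by handing `Ψ` to its functionals: `IsPsiFarWarm`/`IsPsiAgitated` here, counts and the glue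
`[BHSᵇ] ⟸ [SBHS♮ᵇ] ∧ [FWS♮ᵇ]`, `[FWS♮ᵇ] ⟸` tame-ball tilt–strain via `lt_sigma_of_psiFarWarm`, to follow].  Every existing door or lemma with a per-star
`IsTameOn` HYPOTHESIS stays valid and is reached through `IsCoherentTameOn.isTameOn`; no landed file is touched.

0 sorry · imports = tree ZZZU only · no new defs beyond the seven `Prop`/`Set`-level definitions of ZZZW-1/2 · axioms standard.
Sources: finding memo `FINDING-STACKWINDOW-g89.md` (lens-2 g89); CRITIC-LEDGER rows 1581, 1583; parts UC (`IsTameStar`, `isTameStar_of_tiltStrainData`),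
TR (`IsTiltStrainData`), YE/YEA (`CountSparseBPG`, far-warm observers), YFA (`isTameOn_moat_hotCluster_of_serene`), YHA ([MCMC], the exclusion), YZ ((SC)),
ZZZR–ZZZU (the W2 chain); F. John, CPAM 14 (1961) 391; Friesecke–James–Müller, CPAM 55 (2002) Thm 3.1.
-/

noncomputable section
open scoped BigOperators Classical InnerProductSpace RealInnerProductSpace
open MeasureTheory Set Metric Filter Topology
open Literature.Geometry.DiscreteGeometry (IsTwoShellGoodSet)
open Literature.MathematicalPhysics.StatisticalMechanics (lennardJones card_le_of_separated_of_dist_le)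

namespace Summit.AtomisticToContinuum.Crystallization.Theorems.ChartedZeroExcessLayeredLatticeLiouville

open Summit.AtomisticToContinuum.Crystallization.Theorems.ChartedPlanarOrderRigidityDoor (E3 IsClean atomsIn)
open Summit.AtomisticToContinuum.Crystallization.Theorems.ChartedPlanarOrderDensityDichotomy (μS IsSep)
open Summit.AtomisticToContinuum.Crystallization.Theorems.ChartedPlanarOrderCleanScaleP (IsCleanP IsDoorSetP)
open Summit.AtomisticToContinuum.Crystallization.Theorems.ChartedPlanarOrderMesoCut (LayeredHom EnvClose)
open Summit.AtomisticToContinuum.Crystallization.Theorems.ChartedPlanarOrderDoorLayeredOsc (IsTwoShellAffineGood)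

/-! ### ZZZW-1  Coherent tameness; the Ψ-observer notions; the ♮ key lemma -/

section Coherent

/-- ★ **`IsCoherentTameOn ϑ S H K`** — COHERENT `ϑ`-tameness of the sites of `K`: ONE map `Ψ` (into `H` on every `4`-star of `K`) and a field of
rotations `Q` (determinant `1` on `K`) such that at every `x ∈ K` every `4`-bond `p − x` (`p ∈ S`), rotated by `Q x`, matches the image bond `Ψ p − Ψ x`
within `ϑ`.  The per-star notion `IsTameOn` (part UC) is this with `(Ψ, Q x)` allowed to change from star to star; the tilt–strain data of a window
registration (part TR) are this with `σ ≤ ϑ` on `K` (`isCoherentTameOn_of_tiltStrainData`). [this file, g89] -/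
def IsCoherentTameOn (ϑ : ℝ) (S H K : Set E3) : Prop :=
  ∃ (Ψ : E3 → E3) (Q : E3 → (E3 ≃ₗᵢ[ℝ] E3)),
    (∀ x ∈ K, LinearMap.det ((Q x).toLinearEquiv : E3 →ₗ[ℝ] E3) = 1) ∧
      (∀ x ∈ K, MapsTo Ψ (S ∩ closedBall x 4) H) ∧
        ∀ x ∈ K, ∀ p ∈ S, dist p x ≤ 4 → dist ((Q x) (p - x)) (Ψ p - Ψ x) ≤ ϑ

variable {ϑ ϑ' : ℝ} {S H K K' : Set E3}

/-- THE BRIDGE (PROVED): coherent tameness implies per-star tameness (`(U, g) := (Q x, Ψ)` at every site) — every landed door or lemma with an `IsTameOn`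
hypothesis is reached through this line. [this file, g89] -/
theorem IsCoherentTameOn.isTameOn (h : IsCoherentTameOn ϑ S H K) : IsTameOn ϑ S H K := by
  obtain ⟨Ψ, Q, hdet, hmaps, hb⟩ := h
  exact fun x hx => ⟨Q x, Ψ, hdet x hx, hmaps x hx, hb x hx⟩

/-- coherent tameness is monotone in the threshold and antitone in the set. [formal bookkeeping] -/
theorem IsCoherentTameOn.mono (hle : ϑ ≤ ϑ') (hK : K' ⊆ K) (h : IsCoherentTameOn ϑ S H K) : IsCoherentTameOn ϑ' S H K' := by
  obtain ⟨Ψ, Q, hdet, hmaps, hb⟩ := h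
  exact ⟨Ψ, Q, fun x hx => hdet x (hK hx), fun x hx => hmaps x (hK hx), fun x hx p hp hpx => (hb x (hK hx) p hp hpx).trans hle⟩

/-- VACUITY GUARD: the empty set is coherently tame at every level (so the `K`-free corners of the ♮-leaves are served exactly as before). [this file, g89] -/
theorem isCoherentTameOn_empty (ϑ : ℝ) (S H : Set E3) : IsCoherentTameOn ϑ S H ∅ :=
  ⟨id, fun _ => LinearIsometryEquiv.refl ℝ E3, fun _ h => h.elim, fun _ h => h.elim, fun _ h => h.elim⟩

/-- DICTIONARY (PROVED): tilt–strain data `(Q, σ)` of a map `Ψ : S → H` on `win R` with `σ ≤ ϑ` on `K ⊆ win R` make `K` COHERENTLY `ϑ`-tame — the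
coherent form of part UC's `isTameOn_of_tiltStrainData`; this is how the upstream registration pays for the ♮-hypothesis. [this file, g89] -/
theorem isCoherentTameOn_of_tiltStrainData {R : ℝ} {Ψ : E3 → E3} {Q : E3 → (E3 ≃ₗᵢ[ℝ] E3)} {σ : E3 → ℝ} (hd : IsTiltStrainData S R Ψ Q σ)
    (hΨ : MapsTo Ψ S H) (hKR : K ⊆ atomsIn (μS S) 0 R) (hσ : ∀ x ∈ K, σ x ≤ ϑ) : IsCoherentTameOn ϑ S H K :=
  ⟨Ψ, Q, fun x _ => hd.1 x, fun _ _ _ hp => hΨ hp.1, fun x hx p hp hpx => (hd.2.2 x (hKR hx) p hp hpx).trans (hσ x hx)⟩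

/-- ★ **`IsPsiCool ϑc S H Ψ y`** — the star of `y` is `ϑc`-matched BY THE MAP `Ψ` ITSELF (some rotation `U` of determinant `1`; `Ψ` maps the `4`-star into
`H`).  Per-star tameness with the map PINNED: the Ψ-cool sites of a region are coherently tame with the common map `Ψ`. [this file, g89] -/
def IsPsiCool (ϑc : ℝ) (S H : Set E3) (Ψ : E3 → E3) (y : E3) : Prop :=
  ∃ U : E3 ≃ₗᵢ[ℝ] E3, LinearMap.det (U.toLinearEquiv : E3 →ₗ[ℝ] E3) = 1 ∧ MapsTo Ψ (S ∩ closedBall y 4) H ∧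
    ∀ p ∈ S, dist p y ≤ 4 → dist (U (p - y)) (Ψ p - Ψ y) ≤ ϑc

/-- a Ψ-cool site is `ϑc`-tame. [formal bookkeeping] -/
theorem IsPsiCool.isTameStar {ϑc : ℝ} {Ψ : E3 → E3} {y : E3} (h : IsPsiCool ϑc S H Ψ y) : IsTameStar ϑc S H y := by
  obtain ⟨U, hU, hmaps, hb⟩ := h
  exact ⟨U, Ψ, hU, hmaps, hb⟩

/-- DICTIONARY (PROVED): tilt–strain data with `σ y ≤ ϑc` at a window site make it Ψ-cool (`U := Q y`). [this file, g89] -/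
theorem isPsiCool_of_tiltStrainData {ϑc R : ℝ} {Ψ : E3 → E3} {Q : E3 → (E3 ≃ₗᵢ[ℝ] E3)} {σ : E3 → ℝ} (hd : IsTiltStrainData S R Ψ Q σ)
    (hΨ : MapsTo Ψ S H) {y : E3} (hy : y ∈ atomsIn (μS S) 0 R) (hσ : σ y ≤ ϑc) : IsPsiCool ϑc S H Ψ y :=
  ⟨Q y, hd.1 y, fun _ hp => hΨ hp.1, fun p hp hpy => (hd.2.2 y hy p hp hpy).trans hσ⟩

/-- THE COHERENT SET OF Ψ-COOL SITES (PROVED): if every site of `K` is Ψ-cool, `K` is coherently `ϑc`-tame (common map `Ψ`, rotations chosen sitewise).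
[this file, g89] -/
theorem isCoherentTameOn_of_psiCool {ϑc : ℝ} {Ψ : E3 → E3} (h : ∀ y ∈ K, IsPsiCool ϑc S H Ψ y) : IsCoherentTameOn ϑc S H K := by
  classical
  refine ⟨Ψ, fun y => if hy : y ∈ K then Classical.choose (h y hy) else LinearIsometryEquiv.refl ℝ E3, ?_, ?_, ?_⟩
  · intro y hy
    simp only [dif_pos hy]
    exact (Classical.choose_spec (h y hy)).1
  · intro y hy
    exact (Classical.choose_spec (h y hy)).2.1
  · intro y hy p hp hpy
    simp only [dif_pos hy]
    exact (Classical.choose_spec (h y hy)).2.2 p hp hpy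

/-- ★ **`IsPsiFarWarm ϑc ϑ r S H Ψ y`** — a TAME OBSERVER NOT MATCHED BY `Ψ`: the `r`-ball of `y` is `ϑ`-tame but `y` is not Ψ-cool at level `ϑc`.  Part YE's
`IsFarWarm` with the map pinned (a far-warm site is Ψ-far-warm for every `Ψ`; the converse fails — that gap is the finding). [this file, g89] -/
def IsPsiFarWarm (ϑc ϑ r : ℝ) (S H : Set E3) (Ψ : E3 → E3) (y : E3) : Prop := IsTameBall ϑ r S H y ∧ ¬ IsPsiCool ϑc S H Ψ y

/-- ★ **`IsPsiAgitated ϑc ϑ r ra S H Ψ x`** — some Ψ-far-warm site of `S` lies within `ra` of `x`.  Its negation is Ψ-SERENITY: every tame-balled site within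
`ra` is matched by `Ψ` itself to `ϑc`. [this file, g89] -/
def IsPsiAgitated (ϑc ϑ r ra : ℝ) (S H : Set E3) (Ψ : E3 → E3) (x : E3) : Prop := ∃ y ∈ S, dist y x ≤ ra ∧ IsPsiFarWarm ϑc ϑ r S H Ψ y

/-- a far-warm site (part YE) is Ψ-far-warm for every `Ψ`; hence an agitated site is Ψ-agitated. [formal bookkeeping] -/
theorem IsFarWarm.psiFarWarm {ϑc ϑ r : ℝ} {y : E3} (h : IsFarWarm ϑc ϑ r S H y) (Ψ : E3 → E3) : IsPsiFarWarm ϑc ϑ r S H Ψ y :=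
  ⟨h.1, fun hc => h.2 hc.isTameStar⟩

/-- [formal bookkeeping] -/
theorem IsAgitated.psiAgitated {ϑc ϑ r ra : ℝ} {x : E3} (h : IsAgitated ϑc ϑ r ra S H x) (Ψ : E3 → E3) : IsPsiAgitated ϑc ϑ r ra S H Ψ x := by
  obtain ⟨y, hyS, hyx, hfw⟩ := h
  exact ⟨y, hyS, hyx, hfw.psiFarWarm Ψ⟩

/-- ★ **THE CHEBYSHEV HANDLE (PROVED)**: for ANY tilt–strain data `(Q, σ)` of a map `Ψ : S → H` on `win R`, a Ψ-far-warm window site has `σ > ϑc` — so the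
Ψ-far-warm count of a window is at most the number of tame-balled sites with `σ > ϑc`, paid by the tame-ball cubic mass exactly as part YE pays `[FWSᵇ]`
(`tameBallIncoherentCount_le_of_tiltStrainData`). [this file, g89] -/
theorem lt_sigma_of_psiFarWarm {ϑc ϑ r R : ℝ} {Ψ : E3 → E3} {Q : E3 → (E3 ≃ₗᵢ[ℝ] E3)} {σ : E3 → ℝ} (hd : IsTiltStrainData S R Ψ Q σ)
    (hΨ : MapsTo Ψ S H) {y : E3} (hy : y ∈ atomsIn (μS S) 0 R) (hfw : IsPsiFarWarm ϑc ϑ r S H Ψ y) : ϑc < σ y := by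
  by_contra hle
  exact hfw.2 (isPsiCool_of_tiltStrainData hd hΨ hy (not_lt.1 hle))

/-- ★★ **THE ♮ KEY LEMMA (PROVED): the moat of the hot cluster of a Ψ-SERENE ISOLATED site is COHERENTLY `ϑc`-tame.**  If `x` is Ψ-serene at radius
`ra ≥ r + rsh + q` and isolated at `(q, D)` with `D ≥ 2r + rsh + q`, every site `y` of `moatIn S (hotCluster ϑ q S H x) r (r + rsh)` has a `ϑ`-tame `r`-ball
(as in part YFA) and lies within `ra` of `x`; not being Ψ-far-warm, it is Ψ-cool — and the Ψ-cool sites form ONE coherent family (common map `Ψ`).  Part YFA's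
`isTameOn_moat_hotCluster_of_serene` with the coherence KEPT. [this file, g89] -/
theorem isCoherentTameOn_moat_hotCluster_of_psiSerene {ϑc ϑ r ra q rsh D : ℝ} (hra : r + rsh + q ≤ ra) (hD : 2 * r + rsh + q ≤ D) {Ψ : E3 → E3}
    {x : E3} (hser : ¬ IsPsiAgitated ϑc ϑ r ra S H Ψ x) (hiso : IsHotIsolated ϑ q D S H x) :
    IsCoherentTameOn ϑc S H (moatIn S (hotCluster ϑ q S H x) r (r + rsh)) := by
  refine isCoherentTameOn_of_psiCool (Ψ := Ψ) fun y hy => ?_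
  obtain ⟨hyS, ⟨k, hk, hyk⟩, hfar⟩ := mem_moatIn.1 hy
  have hkx : dist k x ≤ q := hk.2.1
  have hyx' : dist y x ≤ dist y k + dist k x := dist_triangle y k x
  have hyx : dist y x ≤ ra := by linarith
  have hball : IsTameBall ϑ r S H y := by
    intro z hzS hzy
    by_contra hzt
    have hzx' : dist z x ≤ dist z y + dist y x := dist_triangle z y x
    have hzx : dist z x ≤ D := by linarith
    have hzr : r < dist y z := hfar z ⟨hzS, hiso z hzS hzx hzt, hzt⟩
    rw [dist_comm] at hzy
    linarith
  by_contra hyc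
  exact hser ⟨y, hyS, hyx, hball, hyc⟩

end Coherent

/-! ### ZZZW-2  The re-typed special-class leaf (SC♮) and the re-typed targets [MCMCᶜ♮], [MCMC♮] -/

section Leaves

/-- ★★★ **(SC♮) «CoherentZoneShadowCrystalP ϑc ϑp r q rsh rm σ ϑr Rs ε rI ℓ aHi Λ θ s» — THE COHERENTLY COOL SHELL IS ONE PLACED SHADOW CRYSTAL.**
Part YZ's (SC) `CoolZoneShadowCrystalP` with its cool-moat hypothesis `IsTameOn ϑc S H (moatIn S K r (r + rsh))` (per-star) REPLACED by
`IsCoherentTameOn ϑc S H (moatIn S K r (r + rsh))` (ONE map into `H`, rotations per site); every other binder and the conclusion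
`∃ L′ w′ U t, IsCoolShadowCrystal σ ϑr Rs ε r rI ℓ S K H L′ w′ U t` VERBATIM.  WEAKER than (SC) (`coherentZoneShadowCrystalP_of_cool`, PROVED) and — unlike
(SC), refuted in value by «STACK-WINDOW» — provable in principle: with `H₀ := H` (`L′ := L`, `w′ := w`) clause (iii) holds at every radius and the content is
the two-sided `ε`-registration of `S` with ONE rigid copy of `H` on the zone, i.e. a discrete John synthesis from the common map `Ψ` (frame propagation along
bonded chains of the coherently tame moat, or Friesecke–James–Müller on the thick shell).  KINEMATIC · ATTACKABLE · dial `ε ≳ 10·ϑc`.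
Why it might fail: «SEP-MARGIN» — clause (ii) asks `IsSep σ (LayeredHom L′ w′)` with the record `σ = 17/20`; with `H₀ := H` this needs the two-shell
rigidity of the homogeneous CLEAN layered crystal (nearest-neighbour distance `≥ 0.9·(1 − 1/(16√2)) ≈ 0.8602`, margin `1/100` — a lemma NOT yet in the
tree, where only the hard core `27/32 < 17/20` is certified, `isSep_of_isClean`), and a RE-FITTED `H₀` inherits only `27/32` (then re-dial
`σ′ ∈ (2·dB, 27/32]`); and the John constant at `ε = 10⁻⁴` needs `ϑc ≲ 10⁻⁵…10⁻⁶` (the `∃ ϑm` column).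
Sources: part YZ ((SC), `isCoolShadowCrystal_self`); finding «STACK-WINDOW» (lens-2 g89) and CRITIC-LEDGER row 1583; F. John, CPAM 14 (1961) 391–413;
Friesecke–James–Müller, CPAM 55 (2002) Thm 3.1. [this file, g89] -/
def CoherentZoneShadowCrystalP (ϑc ϑp r q rsh rm σ ϑr Rs ε rI ℓ aHi Λ θ s : ℝ) : Prop :=
  ∀ δ : ℝ, 0 < δ → ∀ a : ℝ, 0 < a →
    ∀ S : Set E3, IsDoorSetP aHi δ S → (∀ z : E3, Summable fun y : S => lennardJones (dist z (y : E3))) →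
      (∀ p ∈ S, IsTwoShellAffineGood θ S p) →
        ∀ (L : E3 ≃L[ℝ] E3) (w : ℤ → E3), IsEquilChart a s Λ L w →
          ∀ (x₀ : E3) (K : Set E3), K ⊆ S → (∀ k ∈ K, dist k x₀ ≤ q) →
            IsTameOn ϑp S (LayeredHom (L : E3 →L[ℝ] E3) w) (coreOf S K rm) →
              IsCoherentTameOn ϑc S (LayeredHom (L : E3 →L[ℝ] E3) w) (moatIn S K r (r + rsh)) →
                ∃ (L' : E3 →L[ℝ] E3) (w' : ℤ → E3) (U : E3 ≃ₗᵢ[ℝ] E3) (t : E3),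
                  IsCoolShadowCrystal σ ϑr Rs ε r rI ℓ S K (LayeredHom (L : E3 →L[ℝ] E3) w) L' w' U t

/-- **(SC) ⇒ (SC♮) (PROVED)** — the re-typed leaf is WEAKER (its hypothesis is stronger, through the bridge). [this file, g89] -/
theorem coherentZoneShadowCrystalP_of_cool {ϑc ϑp r q rsh rm σ ϑr Rs ε rI ℓ aHi Λ θ s : ℝ}
    (h : CoolZoneShadowCrystalP ϑc ϑp r q rsh rm σ ϑr Rs ε rI ℓ aHi Λ θ s) : CoherentZoneShadowCrystalP ϑc ϑp r q rsh rm σ ϑr Rs ε rI ℓ aHi Λ θ s :=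
  fun δ hδ a ha S hS hsum hgood L w hLw x₀ K hKS hKq hmild hcoh => h δ hδ a ha S hS hsum hgood L w hLw x₀ K hKS hKq hmild hcoh.isTameOn

/-- ★★ **[MCMCᶜ♮] «MildCoherentMoatClampedCoreP ϑc ϑ ϑp r q rsh ρ rm aHi Λ θ s»** — part YHA's [MCMCᶜ] `MildCoolMoatClampedCoreP` with the cool-moat
hypothesis replaced by COHERENT tameness of the moat; everything else verbatim.  WEAKER than [MCMCᶜ] (PROVED); `⇒ [MCMC♮]` on e⋆-GSC door sets (PROVED).
[this file, g89] -/
def MildCoherentMoatClampedCoreP (ϑc ϑ ϑp r q rsh ρ rm aHi Λ θ s : ℝ) : Prop :=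
  ∀ δ : ℝ, 0 < δ → ∀ a : ℝ, 0 < a →
    ∀ S : Set E3, IsDoorSetP aHi δ S → (∀ z : E3, Summable fun y : S => lennardJones (dist z (y : E3))) →
      (∀ p ∈ S, IsTwoShellAffineGood θ S p) →
        ∀ (L : E3 ≃L[ℝ] E3) (w : ℤ → E3), IsEquilChart a s Λ L w →
          ∀ (x₀ : E3) (K : Set E3), K ⊆ S → (∀ k ∈ K, dist k x₀ ≤ q) →
            IsTameOn ϑp S (LayeredHom (L : E3 →L[ℝ] E3) w) (coreOf S K rm) →
              IsCoherentTameOn ϑc S (LayeredHom (L : E3 →L[ℝ] E3) w) (moatIn S K r (r + rsh)) →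
                IsGrandClampedMin S (coreOf S K ρ) → IsTameOn ϑ S (LayeredHom (L : E3 →L[ℝ] E3) w) K

/-- ★★★ **[MCMC♮] «MildCoherentMoatCorePG ϑc ϑ ϑp r q rsh rm aHi Λ θ s» — THE TARGET OF RECORD OF THE W2 LINE AFTER CRITIC ROW 1583**: part YHA's [MCMC]
`MildCoolMoatCorePG` (θ-good e⋆-GSC door set, equilibrium chart, container `K` in a `q`-ball, `ϑp`-tame `rm`-core) with the cool-moat hypothesis replaced by
COHERENT `ϑc`-tameness of `moatIn S K r (r + rsh)` ⇒ `K` is `ϑ`-tame.  WEAKER than [MCMC] (PROVED); antitone in the moat level (PROVED); consumed upstream by the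
♮ sitewise exclusion `not_hot_psiSerene_isolated_mild_of_mildCoherentMoatCore` (this file), whose Ψ-serenity is what a window registration delivers. [this file, g89] -/
def MildCoherentMoatCorePG (ϑc ϑ ϑp r q rsh rm aHi Λ θ s : ℝ) : Prop :=
  ∀ δ : ℝ, 0 < δ → ∀ a : ℝ, 0 < a →
    ∀ S : Set E3, IsDoorSetPG aHi δ S → (∀ p ∈ S, IsTwoShellAffineGood θ S p) →
      ∀ (L : E3 ≃L[ℝ] E3) (w : ℤ → E3), IsEquilChart a s Λ L w →
        ∀ (x₀ : E3) (K : Set E3), K ⊆ S → (∀ k ∈ K, dist k x₀ ≤ q) →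
          IsTameOn ϑp S (LayeredHom (L : E3 →L[ℝ] E3) w) (coreOf S K rm) →
            IsCoherentTameOn ϑc S (LayeredHom (L : E3 →L[ℝ] E3) w) (moatIn S K r (r + rsh)) →
              IsTameOn ϑ S (LayeredHom (L : E3 →L[ℝ] E3) w) K

variable {ϑc ϑm ϑ ϑp r q rsh ρ rm aHi Λ θ s : ℝ}

/-- **[MCMCᶜ] ⇒ [MCMCᶜ♮] (PROVED)** — WEAKER (through the bridge). [this file, g89] -/
theorem mildCoherentMoatClampedCoreP_of_mildCool (h : MildCoolMoatClampedCoreP ϑc ϑ ϑp r q rsh ρ rm aHi Λ θ s) :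
    MildCoherentMoatClampedCoreP ϑc ϑ ϑp r q rsh ρ rm aHi Λ θ s :=
  fun δ hδ a ha S hS hsum hgood L w hLw x₀ K hKS hKq hmild hcoh hmin => h δ hδ a ha S hS hsum hgood L w hLw x₀ K hKS hKq hmild hcoh.isTameOn hmin

/-- **[MCMC] ⇒ [MCMC♮] (PROVED)** — WEAKER (through the bridge). [this file, g89] -/
theorem mildCoherentMoatCorePG_of_mildCool (h : MildCoolMoatCorePG ϑc ϑ ϑp r q rsh rm aHi Λ θ s) :
    MildCoherentMoatCorePG ϑc ϑ ϑp r q rsh rm aHi Λ θ s :=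
  fun δ hδ a ha S hS hgood L w hLw x₀ K hKS hKq hmild hcoh => h δ hδ a ha S hS hgood L w hLw x₀ K hKS hKq hmild hcoh.isTameOn

/-- **[MCMCᶜ♮](ρ) ⇒ [MCMC♮] (PROVED, every `ρ`)** — as part YHA: on an e⋆-GSC door set every core is grand-clamped-minimal and pair sums are summable.
[this file, g89] -/
theorem mildCoherentMoatCorePG_of_mildClamped (h : MildCoherentMoatClampedCoreP ϑc ϑ ϑp r q rsh ρ rm aHi Λ θ s) :
    MildCoherentMoatCorePG ϑc ϑ ϑp r q rsh rm aHi Λ θ s :=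
  fun δ hδ a ha S hS hgood L w hLw x₀ K hKS hKq hmild hcoh =>
    h δ hδ a ha S hS.isDoorSetP (summable_of_isEStarGSC hS.gsc) hgood L w hLw x₀ K hKS hKq hmild hcoh
      (isGrandClampedMin_of_isEStarGSC hS.gsc (coreOf_subset S K ρ))

/-- **DIAL (PROVED): [MCMC♮] is ANTITONE in the moat level** (`ϑm ≤ ϑc`: a `ϑm`-coherently-tame moat is `ϑc`-coherently-tame, so the `ϑc`-statement
implies the `ϑm`-statement) — the `∃ ϑm` column's dial, as part YIB's `MildCoolMoatCorePG.of_moat_le`. [this file, g89] -/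
theorem MildCoherentMoatCorePG.of_moat_le (hle : ϑm ≤ ϑc) (h : MildCoherentMoatCorePG ϑc ϑ ϑp r q rsh rm aHi Λ θ s) :
    MildCoherentMoatCorePG ϑm ϑ ϑp r q rsh rm aHi Λ θ s :=
  fun δ hδ a ha S hS hgood L w hLw x₀ K hKS hKq hmild hcoh => h δ hδ a ha S hS hgood L w hLw x₀ K hKS hKq hmild (hcoh.mono hle subset_rfl)

/-- **DIAL (PROVED): [MCMC♮] is WEAKER at a lower mild level** (`ϑp' ≤ ϑp`). [this file, g89] -/
theorem MildCoherentMoatCorePG.of_level_le {ϑp' : ℝ} (hle : ϑp' ≤ ϑp) (h : MildCoherentMoatCorePG ϑc ϑ ϑp r q rsh rm aHi Λ θ s) :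
    MildCoherentMoatCorePG ϑc ϑ ϑp' r q rsh rm aHi Λ θ s :=
  fun δ hδ a ha S hS hgood L w hLw x₀ K hKS hKq hmild hcoh =>
    h δ hδ a ha S hS hgood L w hLw x₀ K hKS hKq (IsTameOn.mono hle subset_rfl hmild) hcoh

end Leaves

/-! ### ZZZW-3  The ♮ sitewise exclusion under [MCMC♮] (the upstream entry point of the re-typed counting column) -/

section Exclusion

/-- ★★★ **SITEWISE EXCLUSION IN THE MILD CLASS, ♮ FORM (PROVED)**: under [MCMC♮] (`0 ≤ q`, `ra ≥ r + rsh + q`, `D ≥ 2r + rsh + q`, `rp ≥ q + rm`) no site of a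
θ-good e⋆-GSC door set is HOT ∧ Ψ-SERENE ∧ ISOLATED ∧ MILD-BALLED, for ANY map `Ψ` — part YHA's `not_hot_serene_isolated_mild_of_mildCoolMoatCore` with
serenity w.r.t. far-warm observers replaced by Ψ-serenity (the ♮ key lemma gives the COHERENTLY cool moat, the mild ball gives the mild core).  The re-typed
counting column calls this with the window registration `Ψ` of the B-body (`CountSparseBPG` hands `Ψ` to its functionals). [this file, g89] -/
theorem not_hot_psiSerene_isolated_mild_of_mildCoherentMoatCore {ϑc ϑ ϑp r ra q rsh D rm rp aHi Λ θ s : ℝ} (hq : 0 ≤ q) (hra : r + rsh + q ≤ ra)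
    (hD : 2 * r + rsh + q ≤ D) (hrm : q + rm ≤ rp) (hC : MildCoherentMoatCorePG ϑc ϑ ϑp r q rsh rm aHi Λ θ s) {δ : ℝ} (hδ : 0 < δ) {a : ℝ} (ha : 0 < a)
    {S : Set E3} (hS : IsDoorSetPG aHi δ S) (hgood : ∀ p ∈ S, IsTwoShellAffineGood θ S p) {L : E3 ≃L[ℝ] E3} {w : ℤ → E3} (hLw : IsEquilChart a s Λ L w)
    {Ψ : E3 → E3} {x : E3} (hx : x ∈ S) (hot : ¬ IsTameStar ϑ S (LayeredHom (L : E3 →L[ℝ] E3) w) x)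
    (hser : ¬ IsPsiAgitated ϑc ϑ r ra S (LayeredHom (L : E3 →L[ℝ] E3) w) Ψ x) (hmild : IsTameBall ϑp rp S (LayeredHom (L : E3 →L[ℝ] E3) w) x) :
    ¬ IsHotIsolated ϑ q D S (LayeredHom (L : E3 →L[ℝ] E3) w) x := fun hiso =>
  hot (hC δ hδ a ha S hS hgood L w hLw x (hotCluster ϑ q S (LayeredHom (L : E3 →L[ℝ] E3) w) x) (fun _ hz => hz.1) (fun _ hk => hk.2.1)
    (isTameOn_coreOf_of_isTameBall (fun _ hk => hk.2.1) hrm hmild) (isCoherentTameOn_moat_hotCluster_of_psiSerene hra hD hser hiso) x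
    ⟨hx, by rw [dist_self]; exact hq, hot⟩)

end Exclusion

end Summit.AtomisticToContinuum.Crystallization.Theorems.ChartedZeroExcessLayeredLatticeLiouville

end
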